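import Summits.Parity.BatemanHorn.Theses.RoughValueTransport
import Literature.NumberTheory.Sieve.AletheiaZomleferFukshanskyGarcia2020ApplicationsBrunSieveProofs
import Literature.NumberTheory.Sieve.IntervalResidueClassSieve
import HarnessLib

/-!
# Route `RoughValueTransport`, crux `RoughValueLaw` (stmt-Parity-11390), line `increment-anchoring`:
# the registered stub `stub_sieveBand`

`--supports` file of the checked skeleton
`Summits/Parity/BatemanHorn/Cruxes/RoughValueLaw/Lines/increment-anchoring.lean`
(crux `Summit.Parity.BatemanHorn.Theses.RoughValueTransport.RoughValueLaw`).  It PROVES the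
registered stub `stub_sieveBand` (S1a of the line), verbatim: for every Bateman–Horn system
`f = (f₁, …, f_k)` and every `ε > 0` there is `U₁` such that for every `U ≥ U₁`, eventually in `x`,

  `|Φ_f(x,U) − x·V_f(x,U)| ≤ ε·x·V_f(x,U)`,

where `Φ_f(x,U) = #{1 ≤ n ≤ x : ∀ i, fᵢ(n) > 0 and no prime p < x^{deg fᵢ/U} divides fᵢ(n)}` (the
crux's count, with STAGGERED thresholds `zᵢ = x^{deg fᵢ/U}`), `V_f(x,U) = ∏_{p ≤ x} (1 − ω_f(x,U;p)/p)`
and `ω_f(x,U;p) = #{r mod p : ∃ i, p < zᵢ ∧ p ∣ fᵢ(r)}`.  Everything used is PROVED in the tree; no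
definition and no new fact is introduced.

## The argument (sub-namespace `SieveBand`)

1. The sieve input is the tree's fundamental lemma for an interval sifted by prescribed residue
   classes, `IntervalClassSieve.abs_card_sub_le` (`Literature/NumberTheory/Sieve/IntervalResidueClassSieve.lean`,
   itself from the PROVED uniform Fundamental Lemma `SieveSequence.fundamental_lemma_uniform_holds`):
   with the classes `Ω p = {r mod p : ∃ i, p < zᵢ ∧ p ∣ fᵢ(r)}`, at most
   `S = ∑ deg fᵢ` per prime and `< p` of them (`card_classes_le_sum`, `card_classes_lt`:
   `Ω p ⊆` roots of `∏ fᵢ`, `ω_f(p) < p` by `hasNoFixedPrimeDivisor`, Lagrange), sifting level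
   `z = x^{S/U} ≥ zᵢ` and level of distribution `L = x^{1/4}` (`U ≥ 4S`):
   `|#{n ≤ x : n mod p ∉ Ω p ∀ p < z} − xV(z)| ≤ C_S·xV(z)·e^{−U/(4S)} + x^{1/2}`.
2. `rough_iff`: since `zᵢ ≤ z`, "`n mod p ∉ Ω p` for all `p < z`" is exactly the crux's roughness
   condition; the crux additionally asks `fᵢ(n) > 0`, which fails for at most `n₀` values of `n`
   (`exists_forall_eval_pos`, from `Literature.Barriers.Parity.exists_forall_le_eval_of_leadingCoeff_pos`),
   so the two counts differ by at most `n₀` (`card_rough_le`, `card_le_card_rough_add`).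
3. `prod_eq_prod_primesBelow`: `V(z) = V_f(x,U)` (for `z ≤ p ≤ x` no class is removed).
4. `IntervalClassSieve.le_prod_one_sub_card_div`: `V(z) ≥ c_S/(log z)^{2S} ≥ c_S/(log x)^{2S}`, and
   `(n₀ + x^{1/2})(log x)^{2S} ≤ (εc_S/2)·x` eventually (`eventually_absorb`), so the additive errors
   are `≤ (ε/2)·xV`; with `U₁ = max(4S, 4S·log(2C_S/ε))` the main error is `≤ (ε/2)·xV` too
   (`band_at` assembles the fixed-`x` inequality).  `k = 0`: `Φ = x`, `V = 1`.

The statement is non-uniform in `U` (`∀ U, ∀ᶠ x`) and uses `ω_f(p) < p`, as required by the line's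
docstring (refuter lemmas `not_roughValueLawUniform`, `roughValueLaw_false_without_noFixedPrimeDivisor`).

References: H. Halberstam, H.-E. Richert, *Sieve Methods* (1974), Thm 2.5; J. Friedlander,
H. Iwaniec, *Opera de Cribro* (2010), Cor. 6.10; the line card
`Cruxes/RoughValueLaw/Lines/increment-anchoring.md`.
-/

noncomputable section

open Filter Finset Polynomial
open scoped Topology BigOperators
open Literature.NumberTheory.Sieve

namespace Summit.Parity.BatemanHorn.Cruxes.RoughValueLaw.IncrementAnchoring

namespace SieveBand

/-! ### The removed classes `Ω p = {r mod p : ∃ i, p < wᵢ ∧ p ∣ fᵢ(r)}` -/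

/-- The removed classes are among the roots of `∏ fᵢ` modulo `p`: `#Ω p ≤ ω_f(p)`. [folklore] -/
theorem card_classes_le {k : ℕ} (f : Fin k → ℤ[X]) (p : ℕ) (P : Fin k → Prop)
    [DecidablePred P] :
    #((range p).filter fun r : ℕ => ∃ i, P i ∧ (p : ℤ) ∣ (f i).eval (r : ℤ)) ≤
      polyRootCountMod f p := by
  unfold polyRootCountMod
  refine card_le_card fun r hr => ?_
  rw [mem_filter] at hr ⊢
  obtain ⟨hr, i, -, hi⟩ := hr
  exact ⟨hr, hi.trans (Finset.dvd_prod_of_mem (fun j => (f j).eval (r : ℤ)) (mem_univ i))⟩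

/-- For a Bateman–Horn system, `#Ω p < p` (no fixed prime divisor). [folklore] -/
theorem card_classes_lt {k : ℕ} {f : Fin k → ℤ[X]} (hf : IsBatemanHornSystem f) {p : ℕ}
    (hp : p.Prime) (P : Fin k → Prop) [DecidablePred P] :
    #((range p).filter fun r : ℕ => ∃ i, P i ∧ (p : ℤ) ∣ (f i).eval (r : ℤ)) < p :=
  (card_classes_le f p P).trans_lt (hf.hasNoFixedPrimeDivisor p hp)

/-- For a Bateman–Horn system, `#Ω p ≤ ∑ deg fᵢ` (Lagrange for `∏ fᵢ mod p ≠ 0`). [folklore] -/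
theorem card_classes_le_sum {k : ℕ} {f : Fin k → ℤ[X]} (hf : IsBatemanHornSystem f) {p : ℕ}
    (hp : p.Prime) (P : Fin k → Prop) [DecidablePred P] :
    #((range p).filter fun r : ℕ => ∃ i, P i ∧ (p : ℤ) ∣ (f i).eval (r : ℤ)) ≤
      ∑ i, (f i).natDegree := by
  refine (card_classes_le f p P).trans ?_
  have hlt := hf.hasNoFixedPrimeDivisor p hp
  rw [PolyPrimeCountBrun.polyRootCountMod_eq_single_prod] at hlt ⊢
  exact (PolyPrimeCountBrun.polyRootCountMod_single_le_natDegree_of_lt hp hlt).trans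
    (natDegree_prod_le _ _)

/-- Positivity threshold: every `fᵢ(n) > 0` for `n ≥ n₀`. [folklore] -/
theorem exists_forall_eval_pos {k : ℕ} {f : Fin k → ℤ[X]} (hf : IsBatemanHornSystem f) :
    ∃ n₀ : ℕ, ∀ i, ∀ n : ℕ, n₀ ≤ n → 0 < (f i).eval (n : ℤ) := by
  choose N hN using fun i =>
    Literature.Barriers.Parity.exists_forall_le_eval_of_leadingCoeff_pos
      (hf.natDegree_pos i) (hf.leadingCoeff_pos i) 1
  refine ⟨Finset.univ.sup N, fun i n hn => ?_⟩
  have h := hN i n ((Finset.le_sup (Finset.mem_univ i)).trans hn)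
  exact_mod_cast (show (0 : ℝ) < (((f i).eval (n : ℤ) : ℤ) : ℝ) by linarith)

/-! ### Comparing the crux's count and product with the residue-class sieve -/

/-- With thresholds `wᵢ ≤ z`: "`n mod p ∉ Ω p` for every prime `p < z`" is exactly "no prime
`p < wᵢ` divides `fᵢ(n)`, for every `i`" (`p ∣ fᵢ(n) ↔ p ∣ fᵢ(n mod p)`). [folklore] -/
theorem rough_iff {k : ℕ} (f : Fin k → ℤ[X]) {w : Fin k → ℝ} {z : ℝ} (hwz : ∀ i, w i ≤ z)
    (n : ℕ) :
    (∀ p ∈ Nat.primesBelow ⌈z⌉₊, n % p ∉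
        (range p).filter (fun r : ℕ => ∃ i, (p : ℝ) < w i ∧ (p : ℤ) ∣ (f i).eval (r : ℤ))) ↔
      ∀ i, ∀ p ∈ range ⌈w i⌉₊, p.Prime → ¬ ((p : ℤ) ∣ (f i).eval (n : ℤ)) := by
  constructor
  · intro h i p hp hpp hdvd
    have hpw : (p : ℝ) < w i := Nat.lt_ceil.mp (mem_range.mp hp)
    have hpz : p ∈ Nat.primesBelow ⌈z⌉₊ :=
      Nat.mem_primesBelow.mpr ⟨Nat.lt_ceil.mpr (hpw.trans_le (hwz i)), hpp⟩
    exact h p hpz (mem_filter.mpr ⟨mem_range.mpr (Nat.mod_lt n hpp.pos), i, hpw,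
      (dvd_eval_iff_dvd_eval_mod (f i) p n).mp hdvd⟩)
  · intro h p hp hmem
    rw [mem_filter] at hmem
    obtain ⟨-, i, hpw, hdvd⟩ := hmem
    have hpp := (Nat.mem_primesBelow.mp hp).2
    exact h i p (mem_range.mpr (Nat.lt_ceil.mpr hpw)) hpp
      ((dvd_eval_iff_dvd_eval_mod (f i) p n).mpr hdvd)

/-- The crux's count is at most the sifted count. [folklore] -/
theorem card_rough_le {k : ℕ} (f : Fin k → ℤ[X]) {w : Fin k → ℝ} {z : ℝ} (hwz : ∀ i, w i ≤ z)
    (x : ℕ) :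
    #((Icc 1 x).filter (fun n : ℕ => ∀ i, 0 < (f i).eval (n : ℤ) ∧
        ∀ p ∈ range ⌈w i⌉₊, p.Prime → ¬ ((p : ℤ) ∣ (f i).eval (n : ℤ)))) ≤
      #((Icc 1 x).filter (fun n : ℕ => ∀ p ∈ Nat.primesBelow ⌈z⌉₊, n % p ∉
        (range p).filter (fun r : ℕ => ∃ i, (p : ℝ) < w i ∧ (p : ℤ) ∣ (f i).eval (r : ℤ)))) := by
  refine card_le_card fun n hn => ?_
  rw [mem_filter] at hn ⊢
  exact ⟨hn.1, (rough_iff f hwz n).mpr fun i => (hn.2 i).2⟩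

/-- The sifted count exceeds the crux's count by at most the positivity threshold `n₀`. [folklore] -/
theorem card_le_card_rough_add {k : ℕ} (f : Fin k → ℤ[X]) {w : Fin k → ℝ} {z : ℝ}
    (hwz : ∀ i, w i ≤ z) (x : ℕ) {n₀ : ℕ} (hn₀ : ∀ i, ∀ n : ℕ, n₀ ≤ n → 0 < (f i).eval (n : ℤ)) :
    #((Icc 1 x).filter (fun n : ℕ => ∀ p ∈ Nat.primesBelow ⌈z⌉₊, n % p ∉
        (range p).filter (fun r : ℕ => ∃ i, (p : ℝ) < w i ∧ (p : ℤ) ∣ (f i).eval (r : ℤ)))) ≤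
      #((Icc 1 x).filter (fun n : ℕ => ∀ i, 0 < (f i).eval (n : ℤ) ∧
        ∀ p ∈ range ⌈w i⌉₊, p.Prime → ¬ ((p : ℤ) ∣ (f i).eval (n : ℤ)))) + n₀ := by
  calc #((Icc 1 x).filter (fun n : ℕ => ∀ p ∈ Nat.primesBelow ⌈z⌉₊, n % p ∉
        (range p).filter (fun r : ℕ => ∃ i, (p : ℝ) < w i ∧ (p : ℤ) ∣ (f i).eval (r : ℤ))))
      ≤ #((Icc 1 x).filter (fun n : ℕ => ∀ i, 0 < (f i).eval (n : ℤ) ∧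
          ∀ p ∈ range ⌈w i⌉₊, p.Prime → ¬ ((p : ℤ) ∣ (f i).eval (n : ℤ))) ∪ range n₀) := by
        refine card_le_card fun n hn => ?_
        rw [mem_filter] at hn
        rw [mem_union, mem_filter, mem_range]
        by_cases hnn : n₀ ≤ n
        · exact Or.inl ⟨hn.1, fun i => ⟨hn₀ i n hnn, (rough_iff f hwz n).mp hn.2 i⟩⟩
        · exact Or.inr (not_le.mp hnn)
    _ ≤ _ := (card_union_le _ _).trans (by rw [card_range])

/-- For `wᵢ ≤ z ≤ x + 1` the sieve product over the primes `< z` equals the crux's product over the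
primes `≤ x`: no class is removed modulo a prime `p ≥ z`. [folklore] -/
theorem prod_eq_prod_primesBelow {k : ℕ} (f : Fin k → ℤ[X]) {w : Fin k → ℝ} {z : ℝ}
    (hwz : ∀ i, w i ≤ z) {x : ℕ} (hzx : z ≤ (x : ℝ) + 1) :
    ∏ p ∈ Nat.primesBelow ⌈z⌉₊, (1 - (#((range p).filter (fun r : ℕ => ∃ i,
        (p : ℝ) < w i ∧ (p : ℤ) ∣ (f i).eval (r : ℤ))) : ℝ) / (p : ℝ)) =
      ∏ p ∈ Nat.primesBelow (x + 1), (1 - (#((range p).filter (fun r : ℕ => ∃ i,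
        (p : ℝ) < w i ∧ (p : ℤ) ∣ (f i).eval (r : ℤ))) : ℝ) / (p : ℝ)) := by
  apply Finset.prod_subset
  · exact Nat.primesBelow_mono (Nat.ceil_le.mpr (by exact_mod_cast hzx))
  · intro p hp hnp
    have hpp := (Nat.mem_primesBelow.mp hp).2
    have hzp : z ≤ p := by
      by_contra hlt
      exact hnp (Nat.mem_primesBelow.mpr ⟨Nat.lt_ceil.mpr (not_le.mp hlt), hpp⟩)
    have hempty : (range p).filter (fun r : ℕ => ∃ i,
        (p : ℝ) < w i ∧ (p : ℤ) ∣ (f i).eval (r : ℤ)) = ∅ := by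
      refine Finset.filter_false_of_mem fun r _ => ?_
      rintro ⟨i, hi, -⟩
      exact absurd (hi.trans_le (hwz i)) (not_lt.mpr hzp)
    rw [hempty, card_empty, Nat.cast_zero, zero_div, sub_zero]

/-! ### The error terms -/

/-- `(n₀ + √x)(log x)^m ≤ κ x` eventually, for every `κ > 0` (`(log x)^m = o(√x)`). [folklore] -/
theorem eventually_absorb (m n₀ : ℕ) {κ : ℝ} (hκ : 0 < κ) :
    ∀ᶠ x : ℕ in atTop,
      ((n₀ : ℝ) + ((x : ℝ) ^ (1 / 4 : ℝ)) ^ 2) * Real.log x ^ m ≤ κ * x := by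
  have h1 : (fun t : ℝ => Real.log t ^ (m : ℝ)) =o[atTop] fun t => t ^ (1 / 2 : ℝ) :=
    isLittleO_log_rpow_rpow_atTop (m : ℝ) (by norm_num)
  have h2 : ∀ᶠ t : ℝ in atTop, ‖Real.log t ^ (m : ℝ)‖ ≤ κ / 2 * ‖t ^ (1 / 2 : ℝ)‖ :=
    h1.bound (by positivity)
  have h3 : ∀ᶠ x : ℕ in atTop, ‖Real.log x ^ (m : ℝ)‖ ≤ κ / 2 * ‖(x : ℝ) ^ (1 / 2 : ℝ)‖ :=
    tendsto_natCast_atTop_atTop.eventually h2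
  filter_upwards [h3, eventually_ge_atTop (max 1 (n₀ ^ 2))] with x hx hx'
  have hx1 : (1 : ℝ) ≤ x := by exact_mod_cast le_trans (le_max_left _ _) hx'
  have hx0 : (0 : ℝ) ≤ x := by linarith
  have hlog : 0 ≤ Real.log x := Real.log_nonneg hx1
  have hsqrt0 : 0 ≤ (x : ℝ) ^ (1 / 2 : ℝ) := Real.rpow_nonneg hx0 _
  rw [Real.norm_of_nonneg (Real.rpow_nonneg hlog _), Real.norm_of_nonneg hsqrt0,
    Real.rpow_natCast] at hx
  have hL2 : ((x : ℝ) ^ (1 / 4 : ℝ)) ^ 2 = (x : ℝ) ^ (1 / 2 : ℝ) := by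
    rw [← Real.rpow_natCast, ← Real.rpow_mul hx0]; norm_num
  have hn₀ : (n₀ : ℝ) ≤ (x : ℝ) ^ (1 / 2 : ℝ) := by
    have hsq : ((n₀ : ℝ)) ^ 2 ≤ x := by exact_mod_cast le_trans (le_max_right _ _) hx'
    rw [← Real.sqrt_eq_rpow]
    exact Real.le_sqrt_of_sq_le hsq
  have hhalf : (x : ℝ) ^ (1 / 2 : ℝ) * (x : ℝ) ^ (1 / 2 : ℝ) = x := by
    rw [← Real.rpow_add' hx0 (by norm_num)]; norm_num
  rw [hL2]
  calc ((n₀ : ℝ) + (x : ℝ) ^ (1 / 2 : ℝ)) * Real.log x ^ m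
      ≤ (2 * (x : ℝ) ^ (1 / 2 : ℝ)) * (κ / 2 * (x : ℝ) ^ (1 / 2 : ℝ)) :=
        mul_le_mul (by linarith) hx (pow_nonneg hlog m) (by positivity)
    _ = κ * ((x : ℝ) ^ (1 / 2 : ℝ) * (x : ℝ) ^ (1 / 2 : ℝ)) := by ring
    _ = κ * x := by rw [hhalf]

/-- **The band at a fixed `x`** (assembly).  Given thresholds `wᵢ ≤ z ≤ x`, `z ≥ 2`, the residue-class
fundamental lemma for the classes `Ω` at level `L` (`hgen`), `C e^{−s} ≤ ε/2`, the lower bound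
`V(z) ≥ c/(log z)^{2S}` and the absorption `(n₀ + L²)(log x)^{2S} ≤ (εc/2) x`, the crux's count is
within `ε·xV` of `xV`. [folklore] -/
theorem band_at {k : ℕ} (f : Fin k → ℤ[X]) (w : Fin k → ℝ) {z L C c ε s : ℝ} {x n₀ S : ℕ}
    (hwz : ∀ i, w i ≤ z) (hz2 : 2 ≤ z) (hzx : z ≤ x)
    (hn₀ : ∀ i, ∀ n : ℕ, n₀ ≤ n → 0 < (f i).eval (n : ℤ))
    (hgen : |(#((Icc 1 x).filter (fun n : ℕ => ∀ p ∈ Nat.primesBelow ⌈z⌉₊, n % p ∉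
        (range p).filter (fun r : ℕ => ∃ i, (p : ℝ) < w i ∧ (p : ℤ) ∣ (f i).eval (r : ℤ)))) : ℝ) -
          x * ∏ p ∈ Nat.primesBelow ⌈z⌉₊, (1 - (#((range p).filter (fun r : ℕ => ∃ i,
            (p : ℝ) < w i ∧ (p : ℤ) ∣ (f i).eval (r : ℤ))) : ℝ) / p)| ≤
        C * x * (∏ p ∈ Nat.primesBelow ⌈z⌉₊, (1 - (#((range p).filter (fun r : ℕ => ∃ i,
            (p : ℝ) < w i ∧ (p : ℤ) ∣ (f i).eval (r : ℤ))) : ℝ) / p)) * Real.exp (-s) + L ^ 2)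
    (hCs : C * Real.exp (-s) ≤ ε / 2)
    (hlow : c / Real.log z ^ (2 * S) ≤ ∏ p ∈ Nat.primesBelow ⌈z⌉₊, (1 - (#((range p).filter
        (fun r : ℕ => ∃ i, (p : ℝ) < w i ∧ (p : ℤ) ∣ (f i).eval (r : ℤ))) : ℝ) / p))
    (hc : 0 < c) (hε : 0 < ε)
    (habs : ((n₀ : ℝ) + L ^ 2) * Real.log x ^ (2 * S) ≤ ε * c / 2 * x) :
    |((#((Icc 1 x).filter (fun n : ℕ => ∀ i, 0 < (f i).eval (n : ℤ) ∧
          ∀ p ∈ range ⌈w i⌉₊, p.Prime → ¬ ((p : ℤ) ∣ (f i).eval (n : ℤ))))) : ℝ) -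
        (x : ℝ) * ∏ p ∈ Nat.primesBelow (x + 1), (1 - (#((range p).filter (fun r : ℕ => ∃ i,
          (p : ℝ) < w i ∧ (p : ℤ) ∣ (f i).eval (r : ℤ))) : ℝ) / (p : ℝ))| ≤
      ε * ((x : ℝ) * ∏ p ∈ Nat.primesBelow (x + 1), (1 - (#((range p).filter (fun r : ℕ => ∃ i,
          (p : ℝ) < w i ∧ (p : ℤ) ∣ (f i).eval (r : ℤ))) : ℝ) / (p : ℝ))) := by
  have hzx1 : z ≤ (x : ℝ) + 1 := by linarith
  rw [← prod_eq_prod_primesBelow f hwz hzx1]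
  set V : ℝ := ∏ p ∈ Nat.primesBelow ⌈z⌉₊, (1 - (#((range p).filter (fun r : ℕ => ∃ i,
    (p : ℝ) < w i ∧ (p : ℤ) ∣ (f i).eval (r : ℤ))) : ℝ) / p) with hV
  set Q : ℕ := #((Icc 1 x).filter (fun n : ℕ => ∀ p ∈ Nat.primesBelow ⌈z⌉₊, n % p ∉
    (range p).filter (fun r : ℕ => ∃ i, (p : ℝ) < w i ∧ (p : ℤ) ∣ (f i).eval (r : ℤ)))) with hQ
  set Φ : ℕ := #((Icc 1 x).filter (fun n : ℕ => ∀ i, 0 < (f i).eval (n : ℤ) ∧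
    ∀ p ∈ range ⌈w i⌉₊, p.Prime → ¬ ((p : ℤ) ∣ (f i).eval (n : ℤ)))) with hΦ
  have hx2 : (2 : ℝ) ≤ x := hz2.trans hzx
  have hx0 : (0 : ℝ) < x := by linarith
  have hlogz : 0 < Real.log z := Real.log_pos (by linarith)
  have hlogx : 0 < Real.log x := Real.log_pos (by linarith)
  have hlogzx : Real.log z ^ (2 * S) ≤ Real.log x ^ (2 * S) :=
    pow_le_pow_left₀ hlogz.le (Real.log_le_log (by linarith) hzx) _
  have hLz : 0 < Real.log z ^ (2 * S) := pow_pos hlogz _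
  have hLx : 0 < Real.log x ^ (2 * S) := pow_pos hlogx _
  -- the lower bound for `V` and the absorption of the additive errors
  have hVc : c / Real.log x ^ (2 * S) ≤ V :=
    (div_le_div_of_nonneg_left hc.le hLz hlogzx).trans hlow
  have hV0 : 0 < V := lt_of_lt_of_le (div_pos hc hLx) hVc
  have hxV : 0 ≤ (x : ℝ) * V := by positivity
  have hsmall : (n₀ : ℝ) + L ^ 2 ≤ ε / 2 * ((x : ℝ) * V) := by
    have h1 : (n₀ : ℝ) + L ^ 2 ≤ ε * c / 2 * x / Real.log x ^ (2 * S) := by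
      rw [le_div_iff₀ hLx]; exact habs
    have h2 : ε * c / 2 * x / Real.log x ^ (2 * S) = ε / 2 * ((x : ℝ) * (c / Real.log x ^ (2 * S))) := by
      ring
    rw [h2] at h1
    exact h1.trans (mul_le_mul_of_nonneg_left (mul_le_mul_of_nonneg_left hVc hx0.le) (by linarith))
  -- the main error
  have hmain : C * x * V * Real.exp (-s) ≤ ε / 2 * ((x : ℝ) * V) := by
    calc C * x * V * Real.exp (-s) = C * Real.exp (-s) * ((x : ℝ) * V) := by ring
      _ ≤ ε / 2 * ((x : ℝ) * V) := mul_le_mul_of_nonneg_right hCs hxV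
  -- the two counts
  have hΦQ : (Φ : ℝ) ≤ Q := by exact_mod_cast card_rough_le f hwz x
  have hQΦ : (Q : ℝ) ≤ Φ + n₀ := by exact_mod_cast card_le_card_rough_add f hwz x hn₀
  have hQT : |(Q : ℝ) - x * V| ≤ ε / 2 * ((x : ℝ) * V) + L ^ 2 := hgen.trans (by linarith)
  rw [abs_le] at hQT ⊢
  constructor <;> nlinarith [hQT.1, hQT.2, hsmall, hΦQ, hQΦ, hxV, hε]

end SieveBand

/-- **S1a — `stub_sieveBand`: the two-sided fundamental lemma along a Bateman–Horn system, as a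
relative band** (the registered stub of the line `increment-anchoring`, verbatim).  For every
Bateman–Horn system `f` and every `ε > 0` there is `U₁` such that for every `U ≥ U₁`, eventually in
`x`, `|Φ_f(x,U) − x·V_f(x,U)| ≤ ε·x·V_f(x,U)`.  Proof: `SieveBand.band_at` fed with the residue-class
fundamental lemma `IntervalClassSieve.abs_card_sub_le` (classes `Ω p = {r : ∃ i, p < x^{deg fᵢ/U}, p ∣ fᵢ(r)}`,
`#Ω p ≤ ∑ deg fᵢ`, `#Ω p < p`; `z = x^{∑deg fᵢ/U}`, level `x^{1/4}`, `U₁ = max(4S, 4S log(2C/ε))`),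
the lower bound `IntervalClassSieve.le_prod_one_sub_card_div` and `SieveBand.eventually_absorb`;
`k = 0` is trivial (`Φ = x`, `V = 1`). [folklore] -/
theorem stub_sieveBand :
    ∀ (k : ℕ) (f : Fin k → Polynomial ℤ), IsBatemanHornSystem f →
      ∀ ε : ℝ, 0 < ε → ∃ U₁ : ℝ, ∀ U : ℝ, U₁ ≤ U → ∀ᶠ x : ℕ in atTop,
        |((((Icc 1 x).filter (fun n : ℕ => ∀ i, 0 < (f i).eval (n : ℤ) ∧
              ∀ p ∈ range ⌈(x : ℝ) ^ (((f i).natDegree : ℝ) / U)⌉₊,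
                p.Prime → ¬ ((p : ℤ) ∣ (f i).eval (n : ℤ)))).card : ℝ) -
            (x : ℝ) * ∏ p ∈ Nat.primesBelow (x + 1),
              (1 - (((range p).filter (fun r : ℕ => ∃ i,
                  (p : ℝ) < (x : ℝ) ^ (((f i).natDegree : ℝ) / U) ∧
                    (p : ℤ) ∣ (f i).eval (r : ℤ))).card : ℝ) / (p : ℝ)))| ≤
          ε * ((x : ℝ) * ∏ p ∈ Nat.primesBelow (x + 1),
              (1 - (((range p).filter (fun r : ℕ => ∃ i,
                  (p : ℝ) < (x : ℝ) ^ (((f i).natDegree : ℝ) / U) ∧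
                    (p : ℤ) ∣ (f i).eval (r : ℤ))).card : ℝ) / (p : ℝ))) := by
  intro k f hf ε hε
  rcases Nat.eq_zero_or_pos k with hk | hk
  · subst hk
    refine ⟨0, fun U _ => Eventually.of_forall fun x => ?_⟩
    simp
    positivity
  -- `k ≥ 1`: the degrees
  set S : ℕ := ∑ i, (f i).natDegree with hS
  have hSpos : 0 < S := by
    rw [hS]
    exact Finset.sum_pos (fun i _ => hf.natDegree_pos i) ⟨⟨0, hk⟩, mem_univ _⟩
  have hS0 : (0 : ℝ) < S := by exact_mod_cast hSpos
  obtain ⟨C, hC, hFL⟩ := IntervalClassSieve.abs_card_sub_le S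
  obtain ⟨c, hc, hlow⟩ := IntervalClassSieve.le_prod_one_sub_card_div S
  obtain ⟨n₀, hn₀⟩ := SieveBand.exists_forall_eval_pos hf
  refine ⟨max (4 * S) (4 * S * Real.log (2 * C / ε)), fun U hU => ?_⟩
  have hU4 : 4 * (S : ℝ) ≤ U := le_trans (le_max_left _ _) hU
  have hUlog : 4 * S * Real.log (2 * C / ε) ≤ U := le_trans (le_max_right _ _) hU
  have hU0 : 0 < U := by linarith
  have hSU : (S : ℝ) / U ≤ 1 / 4 := by
    rw [div_le_iff₀ hU0]; linarith
  have hSU0 : 0 < (S : ℝ) / U := div_pos hS0 hU0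
  have hSU1 : (S : ℝ) / U ≤ 1 := hSU.trans (by norm_num)
  -- the main error: `C e^{-U/(4S)} ≤ ε/2`
  have hCs : C * Real.exp (-(U / (4 * S))) ≤ ε / 2 := by
    have h1 : Real.log (2 * C / ε) ≤ U / (4 * S) := by
      rw [le_div_iff₀ (by positivity)]; linarith
    have h2 : Real.exp (-(U / (4 * S))) ≤ ε / (2 * C) := by
      calc Real.exp (-(U / (4 * S))) ≤ Real.exp (-Real.log (2 * C / ε)) :=
            Real.exp_le_exp.mpr (by linarith)
        _ = ε / (2 * C) := by
            rw [Real.exp_neg, Real.exp_log (by positivity), inv_div]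
    calc C * Real.exp (-(U / (4 * S))) ≤ C * (ε / (2 * C)) :=
          mul_le_mul_of_nonneg_left h2 hC.le
      _ = ε / 2 := by field_simp
  -- eventual conditions on `x`
  have hz2 : ∀ᶠ x : ℕ in atTop, (2 : ℝ) ≤ (x : ℝ) ^ ((S : ℝ) / U) :=
    ((tendsto_rpow_atTop hSU0).comp tendsto_natCast_atTop_atTop).eventually_ge_atTop 2
  have habs := SieveBand.eventually_absorb (2 * S) n₀ (by positivity : 0 < ε * c / 2)
  filter_upwards [hz2, habs, eventually_ge_atTop 2] with x hzx habsx hx2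
  have hx1 : (1 : ℝ) ≤ x := by exact_mod_cast le_trans one_le_two hx2
  have hx0 : (0 : ℝ) < x := by linarith
  -- thresholds `wᵢ = x^{dᵢ/U} ≤ z = x^{S/U} ≤ L = x^{1/4}`, `z ≤ x`
  have hdS : ∀ i, ((f i).natDegree : ℝ) ≤ S := fun i => by
    rw [hS]
    exact_mod_cast Finset.single_le_sum (f := fun j => (f j).natDegree) (fun j _ => Nat.zero_le _)
      (mem_univ i)
  have hwz : ∀ i, (x : ℝ) ^ (((f i).natDegree : ℝ) / U) ≤ (x : ℝ) ^ ((S : ℝ) / U) := fun i =>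
    Real.rpow_le_rpow_of_exponent_le hx1 (div_le_div_of_nonneg_right (hdS i) hU0.le)
  have hzL : (x : ℝ) ^ ((S : ℝ) / U) ≤ (x : ℝ) ^ (1 / 4 : ℝ) :=
    Real.rpow_le_rpow_of_exponent_le hx1 hSU
  have hzx' : (x : ℝ) ^ ((S : ℝ) / U) ≤ x := by
    conv_rhs => rw [← Real.rpow_one (x : ℝ)]
    exact Real.rpow_le_rpow_of_exponent_le hx1 hSU1
  have hs : Real.log ((x : ℝ) ^ (1 / 4 : ℝ)) / Real.log ((x : ℝ) ^ ((S : ℝ) / U)) = U / (4 * S) := by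
    have hlogx : 0 < Real.log x := Real.log_pos (by linarith)
    rw [Real.log_rpow hx0, Real.log_rpow hx0]
    field_simp
  -- the classes
  have hΩlt : ∀ p : ℕ, p.Prime → ∀ r ∈ (range p).filter (fun r : ℕ => ∃ i,
      (p : ℝ) < (x : ℝ) ^ (((f i).natDegree : ℝ) / U) ∧ (p : ℤ) ∣ (f i).eval (r : ℤ)), r < p :=
    fun p _ r hr => mem_range.mp (mem_filter.mp hr).1
  have hΩle : ∀ p : ℕ, p.Prime → #((range p).filter (fun r : ℕ => ∃ i,
      (p : ℝ) < (x : ℝ) ^ (((f i).natDegree : ℝ) / U) ∧ (p : ℤ) ∣ (f i).eval (r : ℤ))) ≤ S :=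
    fun p hp => by
      rw [hS]
      exact SieveBand.card_classes_le_sum hf hp
        (fun i => (p : ℝ) < (x : ℝ) ^ (((f i).natDegree : ℝ) / U))
  have hΩp : ∀ p : ℕ, p.Prime → #((range p).filter (fun r : ℕ => ∃ i,
      (p : ℝ) < (x : ℝ) ^ (((f i).natDegree : ℝ) / U) ∧ (p : ℤ) ∣ (f i).eval (r : ℤ))) < p :=
    fun p hp => SieveBand.card_classes_lt hf hp
      (fun i => (p : ℝ) < (x : ℝ) ^ (((f i).natDegree : ℝ) / U))
  have hgen := hFL x (fun p => (range p).filter (fun r : ℕ => ∃ i,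
      (p : ℝ) < (x : ℝ) ^ (((f i).natDegree : ℝ) / U) ∧ (p : ℤ) ∣ (f i).eval (r : ℤ)))
    hΩlt hΩle hΩp _ _ hzx hzL
  have hlowx := hlow (fun p => (range p).filter (fun r : ℕ => ∃ i,
      (p : ℝ) < (x : ℝ) ^ (((f i).natDegree : ℝ) / U) ∧ (p : ℤ) ∣ (f i).eval (r : ℤ)))
    hΩle hΩp _ hzx
  rw [hs] at hgen
  exact SieveBand.band_at f (fun i => (x : ℝ) ^ (((f i).natDegree : ℝ) / U)) hwz hzx hzx' hn₀
    hgen hCs hlowx hc hε habsx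

end Summit.Parity.BatemanHorn.Cruxes.RoughValueLaw.IncrementAnchoring
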